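import Summits.QuantumFields.YangMills.Theorems.AllWindowsColdBoxBoxHighLineLandauSecondOrderOf
import Summits.QuantumFields.YangMills.Theorems.AllWindowsColdBoxBoxHighLineTiltCum3Sizes
import Summits.QuantumFields.YangMills.Theorems.AllWindowsColdBoxBoxHighLineTiltCum4Bound

/-!
# T-S5.13 — `landauSecondOrder`: the v13 stub `stub_landauSecondOrder` of LINE-19, UNCONDITIONAL (Theorems-side Props)
# (LEAD ym-line-sfw-p2 g77 GO 2026-08-29T21:36:42Z «w3 = hands»; skeleton `Cruxes/BoxHighWindowsSU22/Lines/landau_sector_relative_bl.lean` v13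
# 017557256013; LINE-19 S5 ⟨stmt-QuantumFields-24004⟩/⟨24335⟩)

Width seat `ym-line-sfw-p2-w3` (g40).  The one-liner `landauSecondOrder_of K3 K4` over ✓`…LandauSecondOrderOf` with the two last inputs now in the
tree BY NAME: K3 = ✓`GaussNormalForm.abs_tiltCum3_muD_zero_chartPlaqCost_le_sizes` (fcl-p3 g26, `…TiltCum3Sizes`) and K4 =
✓`GaussNormalForm.abs_tiltCum4_muD_le_rpow` (w5 g23, `…TiltCum4Bound`).

The statement is the v13 stub signature with the Theorems-side copies of the line's Props (✓`…BoxHighWindowsSU22LineDefs`: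
`HodgePoincareColdBox`, `DirProjKernelHodgeForm`, `LandauVarianceBounded`, `LandauKernelDecay`, `LandauBootstrapBound`, `GaugeBallReduction`;
✓`…BulkCurrency.LandauRelativeComparisonBulk`); the skeleton's own copies are definitionally equal, so the skeleton's `stub_landauSecondOrder`
is closed by `exact landauSecondOrder` up to `unfold` (planner/LEAD wire it).

HONEST LABEL: S5 (STEP 2 of LINE-19) as a Theorems-side theorem; the skeleton stub, U5 (`BoxWindowHighSU2213`, the RG residual ⟨24336⟩), the crux
⟨24004⟩ and the low window ⟨24335⟩ are NOT closed by this file alone (the skeleton's composition `BoxWindowLowSU2213_of` needs S1–S5 wired, and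
⟨24004⟩ needs the HIGH residual); no rung or summit is proved; **the Yang–Mills mass gap is NOT proved by this file; no summit is proved by a line.**
-/

set_option autoImplicit false

namespace Summit.QuantumFields.YangMills.Theorems.AllWindowsColdBoxBoxHighLine

/-- ★★★ **S5 `stub_landauSecondOrder` (v13), UNCONDITIONAL, Theorems side**: for every `θL < 5/64` (the S1–S4 hypotheses carried, unused)
the BULK relative Dirichlet comparison `LandauRelativeComparisonBulk θL` holds. -/
theorem landauSecondOrder : ∀ θL : ℝ, θL < 5 / 64 → HodgePoincareColdBox → DirProjKernelHodgeForm →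
    LandauVarianceBounded ∧ LandauKernelDecay → LandauBootstrapBound →
    (∃ κ : ℝ, 0 < κ ∧ κ < 1 / 2 - 3 * θL ∧ GaugeBallReduction θL κ) → LandauRelativeComparisonBulk θL :=
  landauSecondOrder_of GaussNormalForm.abs_tiltCum3_muD_zero_chartPlaqCost_le_sizes GaussNormalForm.abs_tiltCum4_muD_le_rpow

end Summit.QuantumFields.YangMills.Theorems.AllWindowsColdBoxBoxHighLine
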